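import Summits.KontsevichZagierPeriods.KontsevichZagierPeriods.Theorems.SymplecticScissorsRealOnePeriodRelationsStubCellGreenAux2

/-!
# `RealOnePeriodRelations` (stmt-KontsevichZagierPeriods-10042), line `nash-retraction-thin-strip` —
# stub `stub_cellGreen`: one chart cell is one instance of Green on the unit square

Given Green on the unit square (hypothesis; the neighbouring stub `stub_greenOnSquare`), a chart
`ψ : ℂ → ℂⁿ` holomorphic on `ball c ε` and `ℚ`-semialgebraic on `closedBall c ρ` (`0 < ρ < ε`), a polynomial
`1`-form `ω = Σ ωᵢ dxᵢ` over `ℚ̄`, an algebraic scalar `a` and four `ℚ`-semialgebraic `C¹` chart paths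
`wb, wr, wt, wl : [0,1] → closedBall c (ρ/4)` with matching corners, the four real realisations
`[∫₀¹ Re(a Σᵢ ωᵢ(ψ(w_e)) (ψᵢ ∘ w_e)′) dt]` satisfy `[b] + [r] − [t] − [l] ∈ M₁`.

Proof: fill the quadrilateral by the bilinear Coons patch `P` (auxiliary files 1–2), pull the holomorphic
form `g(w) dw`, `g = Σᵢ ωᵢ(ψ) ψᵢ′`, back to the typed Green data `A = Re(a·g(P)·∂ᵤP)`, `B = Re(a·g(P)·∂ᵥP)`
on the closed square (semialgebraic and continuous there) with potential `S = Re(a·G∘P)`, `G′ = g` on the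
ball (`DifferentiableOn.isExactOn_ball`), and check that on the four edges `A(t,0), B(1,t), A(t,1), B(0,t)`
ARE the four given integrands (chain rule), so that Green on the square applies to the given representations
themselves. All auxiliary functions enter through characterising hypotheses (no definitions).

References: M. Kontsevich, D. Zagier, *Periods* (2001), §1.2; A. Huber, G. Wüstholz, *Transcendence and
Linear Relations of 1-Periods* (2022), §3.3.1; J. B. Conway, *Functions of One Complex Variable I* (1978),
IV.6.7.
-/

noncomputable section

open scoped BigOperators Topology
open Set Filter Metric
open Literature.NumberTheory.Transcendental Literature.NumberTheory.Transcendental.CurvePeriods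
open Literature.ModelTheory.ExponentialFields (IsSemialgebraic)
open Summit.KontsevichZagierPeriods.SymplecticScissors.RealOnePeriodRelationsNegative (M₁)

namespace Summit.KontsevichZagierPeriods.SymplecticScissors.RealOnePeriodRelations

namespace CellGreen

section CellData

variable {n : ℕ} {ω : Fin n → MvPolynomial (Fin n) ℂ} {a c : ℂ} {ε ρ : ℝ} {ψ : ℂ → (Fin n → ℂ)}
  {wb wr wt wl : ℝ → ℂ} {P Pu Pv : (Fin 2 → ℝ) → ℂ} {g G : ℂ → ℂ} {A B S : (Fin 2 → ℝ) → ℝ}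
  (hω : ∀ i, HasAlgCoeffs (ω i)) (ha : IsAlgebraic ℚ a) (hρ : 0 < ρ) (hρε : ρ < ε)
  (hψ : AnalyticOnNhd ℂ ψ (ball c ε))
  (hψsa : IsSemialgebraicMapOn ℚ {q : Fin 2 → ℝ | (⟨q 0, q 1⟩ : ℂ) ∈ closedBall c ρ}
    (fun q => Fin.append (fun i => (ψ ⟨q 0, q 1⟩ i).re) (fun i => (ψ ⟨q 0, q 1⟩ i).im)))
  (hwb : ContDiffOn ℝ 1 wb (Set.Icc 0 1)) (hwr : ContDiffOn ℝ 1 wr (Set.Icc 0 1))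
  (hwt : ContDiffOn ℝ 1 wt (Set.Icc 0 1)) (hwl : ContDiffOn ℝ 1 wl (Set.Icc 0 1))
  (swb : IsSemialgebraicMapOn ℚ {z : Fin 1 → ℝ | z 0 ∈ Set.Icc (0 : ℝ) 1} (fun z => ![(wb (z 0)).re, (wb (z 0)).im]))
  (swr : IsSemialgebraicMapOn ℚ {z : Fin 1 → ℝ | z 0 ∈ Set.Icc (0 : ℝ) 1} (fun z => ![(wr (z 0)).re, (wr (z 0)).im]))
  (swt : IsSemialgebraicMapOn ℚ {z : Fin 1 → ℝ | z 0 ∈ Set.Icc (0 : ℝ) 1} (fun z => ![(wt (z 0)).re, (wt (z 0)).im]))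
  (swl : IsSemialgebraicMapOn ℚ {z : Fin 1 → ℝ | z 0 ∈ Set.Icc (0 : ℝ) 1} (fun z => ![(wl (z 0)).re, (wl (z 0)).im]))
  (mwb : ∀ t ∈ Set.Icc (0 : ℝ) 1, wb t ∈ closedBall c (ρ / 4))
  (mwr : ∀ t ∈ Set.Icc (0 : ℝ) 1, wr t ∈ closedBall c (ρ / 4))
  (mwt : ∀ t ∈ Set.Icc (0 : ℝ) 1, wt t ∈ closedBall c (ρ / 4))
  (mwl : ∀ t ∈ Set.Icc (0 : ℝ) 1, wl t ∈ closedBall c (ρ / 4))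
  (h00 : wb 0 = wl 0) (h10 : wb 1 = wr 0) (h11 : wr 1 = wt 1) (h01 : wl 1 = wt 0)
  (hP : P = fun p => (1 - (p 1 : ℂ)) * wb (p 0) + (p 1 : ℂ) * wt (p 0) + (1 - (p 0 : ℂ)) * wl (p 1) +
      (p 0 : ℂ) * wr (p 1) -
    ((1 - (p 0 : ℂ)) * (1 - (p 1 : ℂ)) * wb 0 + (p 0 : ℂ) * (1 - (p 1 : ℂ)) * wb 1 +
      (1 - (p 0 : ℂ)) * (p 1 : ℂ) * wt 0 + (p 0 : ℂ) * (p 1 : ℂ) * wt 1))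
  (hPu : Pu = fun p => (1 - (p 1 : ℂ)) * derivWithin wb (Set.Icc 0 1) (p 0) +
      (p 1 : ℂ) * derivWithin wt (Set.Icc 0 1) (p 0) - wl (p 1) + wr (p 1) -
    (-(1 - (p 1 : ℂ)) * wb 0 + (1 - (p 1 : ℂ)) * wb 1 - (p 1 : ℂ) * wt 0 + (p 1 : ℂ) * wt 1))
  (hPv : Pv = fun p => -wb (p 0) + wt (p 0) + (1 - (p 0 : ℂ)) * derivWithin wl (Set.Icc 0 1) (p 1) +
      (p 0 : ℂ) * derivWithin wr (Set.Icc 0 1) (p 1) -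
    (-(1 - (p 0 : ℂ)) * wb 0 - (p 0 : ℂ) * wb 1 + (1 - (p 0 : ℂ)) * wt 0 + (p 0 : ℂ) * wt 1))
  (hg : g = fun w => ∑ i, MvPolynomial.eval (ψ w) (ω i) * deriv (fun u => ψ u i) w)
  (hG : ∀ w ∈ ball c ε, HasDerivAt G (g w) w)
  (hA : A = fun p => (a * g (P p) * Pu p).re) (hB : B = fun p => (a * g (P p) * Pv p).re)
  (hS : S = fun p => (a * G (P p)).re)

/-! ## The typed Green data `A = Re(a·g(P)·∂ᵤP)`, `B = Re(a·g(P)·∂ᵥP)`, `S = Re(a·G(P))` of a cell -/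

include ha in
/-- The algebraic scalar is a constant with semialgebraic real and imaginary parts.
[cite: KontsevichZagier2001, §1.1] -/
theorem a_sa : IsSemialgebraicFunOn ℚ {p : Fin 2 → ℝ | 0 ≤ p 0 ∧ p 0 ≤ 1 ∧ 0 ≤ p 1 ∧ p 1 ≤ 1} (fun _ => a.re) ∧
    IsSemialgebraicFunOn ℚ {p : Fin 2 → ℝ | 0 ≤ p 0 ∧ p 0 ≤ 1 ∧ 0 ≤ p 1 ∧ p 1 ≤ 1} (fun _ => a.im) :=
  have h := isAlgebraic_re_im ha
  re_im_const isSemialgebraic_csq h.1 h.2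

include hω ha hρ hρε hψ hψsa hwb hwt swb swr swt swl mwb mwr mwt mwl hP hPu hg hA in
/-- `A` is `ℚ`-semialgebraic on the closed square. [cite: BochnakCosteRoy1998, Prop. 2.2.6] -/
theorem A_sa : IsSemialgebraicFunOn ℚ {p : Fin 2 → ℝ | 0 ≤ p 0 ∧ p 0 ≤ 1 ∧ 0 ≤ p 1 ∧ p 1 ≤ 1} A := by
  subst hA
  exact (re_im_mul (re_im_mul (a_sa ha) (gP_sa hω hρ hρε hψ hψsa swb swr swt swl mwb mwr mwt mwl hP hg))
    (Pu_sa hwb hwt swb swr swt swl hPu)).1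

include hω ha hρ hρε hψ hψsa hwr hwl swb swr swt swl mwb mwr mwt mwl hP hPv hg hB in
/-- `B` is `ℚ`-semialgebraic on the closed square. [cite: BochnakCosteRoy1998, Prop. 2.2.6] -/
theorem B_sa : IsSemialgebraicFunOn ℚ {p : Fin 2 → ℝ | 0 ≤ p 0 ∧ p 0 ≤ 1 ∧ 0 ≤ p 1 ∧ p 1 ≤ 1} B := by
  subst hB
  exact (re_im_mul (re_im_mul (a_sa ha) (gP_sa hω hρ hρε hψ hψsa swb swr swt swl mwb mwr mwt mwl hP hg))
    (Pv_sa hwr hwl swb swr swt swl hPv)).1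

include hρ hρε hψ hwb hwr hwt hwl mwb mwr mwt mwl hP hg in
/-- `g ∘ P` is continuous on the closed square. [folklore] -/
theorem gP_continuousOn : ContinuousOn (fun p => g (P p)) {p : Fin 2 → ℝ | 0 ≤ p 0 ∧ p 0 ≤ 1 ∧ 0 ≤ p 1 ∧ p 1 ≤ 1} := by
  subst hg
  exact (analyticOnNhd_density ω hψ).continuousOn.comp (P_continuousOn hwb hwr hwt hwl hP) fun _ hp =>
    ball_subset_ball hρε.le (P_mem_ball hρ mwb mwr mwt mwl hP hp)

include hρ hρε hψ hwb hwr hwt hwl mwb mwr mwt mwl hP hPu hg hA in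
/-- `A` is continuous on the closed square. [folklore] -/
theorem A_continuousOn : ContinuousOn A {p : Fin 2 → ℝ | 0 ≤ p 0 ∧ p 0 ≤ 1 ∧ 0 ≤ p 1 ∧ p 1 ≤ 1} := by
  subst hA
  exact Complex.continuous_re.comp_continuousOn ((continuousOn_const.mul
    (gP_continuousOn hρ hρε hψ hwb hwr hwt hwl mwb mwr mwt mwl hP hg)).mul
    (Pu_continuousOn hwb hwr hwt hwl hPu))

include hρ hρε hψ hwb hwr hwt hwl mwb mwr mwt mwl hP hPv hg hB in
/-- `B` is continuous on the closed square. [folklore] -/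
theorem B_continuousOn : ContinuousOn B {p : Fin 2 → ℝ | 0 ≤ p 0 ∧ p 0 ≤ 1 ∧ 0 ≤ p 1 ∧ p 1 ≤ 1} := by
  subst hB
  exact Complex.continuous_re.comp_continuousOn ((continuousOn_const.mul
    (gP_continuousOn hρ hρε hψ hwb hwr hwt hwl mwb mwr mwt mwl hP hg)).mul
    (Pv_continuousOn hwb hwr hwt hwl hPv))

include hρ hρε hwb hwr hwt hwl mwb mwr mwt mwl hP hPu hPv hG hA hB hS in
/-- On the open square, `S` is a potential: `dS = A du + B dv` (chain rule for `G ∘ P`, `G′ = g`).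
[cite: KontsevichZagier2001, §1.2] -/
theorem S_hasFDerivAt {p : Fin 2 → ℝ} (h0 : p 0 ∈ Set.Ioo (0 : ℝ) 1) (h1 : p 1 ∈ Set.Ioo (0 : ℝ) 1) :
    HasFDerivAt S (A p • ContinuousLinearMap.proj (R := ℝ) (φ := fun _ : Fin 2 => ℝ) 0 +
      B p • ContinuousLinearMap.proj (R := ℝ) (φ := fun _ : Fin 2 => ℝ) 1) p := by
  have hp : p ∈ {p : Fin 2 → ℝ | 0 ≤ p 0 ∧ p 0 ≤ 1 ∧ 0 ≤ p 1 ∧ p 1 ≤ 1} := ⟨h0.1.le, h0.2.le, h1.1.le, h1.2.le⟩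
  have hPd := P_hasFDerivAt hwb hwr hwt hwl hP hPu hPv h0 h1
  have hGd : HasDerivAt (fun w => a * G w) (a * g (P p)) (P p) :=
    (hG _ (ball_subset_ball hρε.le (P_mem_ball hρ mwb mwr mwt mwl hP hp))).const_mul a
  have h3 := hGd.comp_hasFDerivAt p hPd
  have h4 := Complex.reCLM.hasFDerivAt.comp p h3
  simp only [Function.comp_def, Complex.reCLM_apply] at h4
  subst hS hA hB
  refine h4.congr_fderiv (ContinuousLinearMap.ext fun x => ?_)
  simp
  ring

/-! ## The four edges -/

include hρ hρε hψ hg in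
/-- Along a `C¹` chart path `w` inside the small disc, `Re(a·g(w t)·w′(t))` is the real integrand
`Re(a Σᵢ ωᵢ(ψ(w t)) · (ψᵢ ∘ w)′(t))` (chain rule). [cite: HuberWustholz2022, §3.3.1] -/
theorem edge_aux {w : ℝ → ℂ} (hw : ContDiffOn ℝ 1 w (Set.Icc 0 1))
    (hm : ∀ t ∈ Set.Icc (0 : ℝ) 1, w t ∈ closedBall c (ρ / 4)) {t : ℝ} (ht : t ∈ Set.Ioo (0 : ℝ) 1) :
    (a * g (w t) * derivWithin w (Set.Icc 0 1) t).re =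
      (a * ∑ i, MvPolynomial.eval (ψ (w t)) (ω i) * deriv (fun u => ψ (w u) i) t).re := by
  subst hg
  have hwt : w t ∈ ball c ε :=
    closedBall_subset_ball (by linarith) (hm t (Ioo_subset_Icc_self ht))
  have hd := hasDerivAt_Icc hw ht
  have hchain : ∀ i, deriv (fun u => ψ (w u) i) t =
      deriv (fun u => ψ u i) (w t) * derivWithin w (Set.Icc 0 1) t := by
    intro i
    have hψi : HasDerivAt (fun u => ψ u i) (deriv (fun u => ψ u i) (w t)) (w t) :=
      ((analyticAt_pi_iff (f := fun j u => ψ u j)).1 (hψ _ hwt) i).differentiableAt.hasDerivAt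
    exact (hψi.comp t hd).deriv
  simp_rw [hchain]
  rw [mul_assoc, Finset.sum_mul]
  congr 2
  exact Finset.sum_congr rfl fun i _ => by ring

include hρ hρε hψ hwb mwb h00 h10 hP hPu hg hA in
/-- Bottom edge: `A(t,0)` is the integrand of `ψ ∘ wb`. [cite: KontsevichZagier2001, §1.2] -/
theorem A_bottom {t : ℝ} (ht : t ∈ Set.Ioo (0 : ℝ) 1) : A ![t, 0] =
    (a * ∑ i, MvPolynomial.eval (ψ (wb t)) (ω i) * deriv (fun u => ψ (wb u) i) t).re := by
  subst hA
  beta_reduce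
  rw [P_bottom h00 h10 hP, Pu_bottom h00 h10 hPu]
  exact edge_aux hρ hρε hψ hg hwb mwb ht

include hρ hρε hψ hwt mwt h11 h01 hP hPu hg hA in
/-- Top edge: `A(t,1)` is the integrand of `ψ ∘ wt`. [cite: KontsevichZagier2001, §1.2] -/
theorem A_top {t : ℝ} (ht : t ∈ Set.Ioo (0 : ℝ) 1) : A ![t, 1] =
    (a * ∑ i, MvPolynomial.eval (ψ (wt t)) (ω i) * deriv (fun u => ψ (wt u) i) t).re := by
  subst hA
  beta_reduce
  rw [P_top h11 h01 hP, Pu_top h11 h01 hPu]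
  exact edge_aux hρ hρε hψ hg hwt mwt ht

include hρ hρε hψ hwl mwl hP hPv hg hB in
/-- Left edge: `B(0,t)` is the integrand of `ψ ∘ wl`. [cite: KontsevichZagier2001, §1.2] -/
theorem B_left {t : ℝ} (ht : t ∈ Set.Ioo (0 : ℝ) 1) : B ![0, t] =
    (a * ∑ i, MvPolynomial.eval (ψ (wl t)) (ω i) * deriv (fun u => ψ (wl u) i) t).re := by
  subst hB
  beta_reduce
  rw [P_left hP, Pv_left hPv]
  exact edge_aux hρ hρε hψ hg hwl mwl ht

include hρ hρε hψ hwr mwr hP hPv hg hB in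
/-- Right edge: `B(1,t)` is the integrand of `ψ ∘ wr`. [cite: KontsevichZagier2001, §1.2] -/
theorem B_right {t : ℝ} (ht : t ∈ Set.Ioo (0 : ℝ) 1) : B ![1, t] =
    (a * ∑ i, MvPolynomial.eval (ψ (wr t)) (ω i) * deriv (fun u => ψ (wr u) i) t).re := by
  subst hB
  beta_reduce
  rw [P_right hP, Pv_right hPv]
  exact edge_aux hρ hρε hψ hg hwr mwr ht

end CellData

end CellGreen

/-! ## The stub -/

/-- STUB `stub_cellGreen` of the line `nash-retraction-thin-strip`: THE CHART CELL. Given Green on the unit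
square (hypothesis), a chart `ψ : ℂ → ℂⁿ` holomorphic on `ball c ε` and `ℚ`-semialgebraic on `closedBall c ρ`
(`0 < ρ < ε`), a polynomial form `ω` over `ℚ̄`, an algebraic scalar `a`, and four `ℚ`-semialgebraic `C¹` chart
paths `wb, wr, wt, wl : [0,1] → closedBall c (ρ/4)` forming a closed quadrilateral (`wb 0 = wl 0`, `wb 1 = wr 0`,
`wr 1 = wt 1`, `wl 1 = wt 0`), the four real realisations of `a·ω` along `ψ ∘ wb, ψ ∘ wr, ψ ∘ wt, ψ ∘ wl`
satisfy `[b] + [r] − [t] − [l] ∈ M₁`: the bilinear Coons patch `P : [0,1]² → ball c ρ` pulls `Re(a·g(w)dw)`,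
`g = Σᵢ ωᵢ(ψ)ψᵢ′`, back to typed Green data `A = Re(a g(P)∂ᵤP)`, `B = Re(a g(P)∂ᵥP)` (semialgebraic and
continuous on the closed square), potential `S = Re(a G∘P)` with `G′ = g` (`DifferentiableOn.isExactOn_ball`),
whose edge densities are the four given integrands. [cite: KontsevichZagier2001, §1.2] -/
theorem stub_cellGreen :
    (∀ (A B S : (Fin 2 → ℝ) → ℝ),
      IsSemialgebraicFunOn ℚ {p : Fin 2 → ℝ | 0 ≤ p 0 ∧ p 0 ≤ 1 ∧ 0 ≤ p 1 ∧ p 1 ≤ 1} A →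
      IsSemialgebraicFunOn ℚ {p : Fin 2 → ℝ | 0 ≤ p 0 ∧ p 0 ≤ 1 ∧ 0 ≤ p 1 ∧ p 1 ≤ 1} B →
      ContinuousOn A {p : Fin 2 → ℝ | 0 ≤ p 0 ∧ p 0 ≤ 1 ∧ 0 ≤ p 1 ∧ p 1 ≤ 1} →
      ContinuousOn B {p : Fin 2 → ℝ | 0 ≤ p 0 ∧ p 0 ≤ 1 ∧ 0 ≤ p 1 ∧ p 1 ≤ 1} →
      (∀ p : Fin 2 → ℝ, 0 < p 0 → p 0 < 1 → 0 < p 1 → p 1 < 1 →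
        HasFDerivAt S (A p • ContinuousLinearMap.proj (R := ℝ) (φ := fun _ : Fin 2 => ℝ) 0 +
          B p • ContinuousLinearMap.proj (R := ℝ) (φ := fun _ : Fin 2 => ℝ) 1) p) →
      ∀ (rB rR rT rL : KZ.IntegralRep 1),
        rB.domain = {z | z 0 ∈ Set.Ioo (0 : ℝ) 1} → rR.domain = {z | z 0 ∈ Set.Ioo (0 : ℝ) 1} →
        rT.domain = {z | z 0 ∈ Set.Ioo (0 : ℝ) 1} → rL.domain = {z | z 0 ∈ Set.Ioo (0 : ℝ) 1} →
        (∀ z ∈ rB.domain, rB.integrand z = A ![z 0, 0]) → (∀ z ∈ rR.domain, rR.integrand z = B ![1, z 0]) →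
        (∀ z ∈ rT.domain, rT.integrand z = A ![z 0, 1]) → (∀ z ∈ rL.domain, rL.integrand z = B ![0, z 0]) →
        KZ.of rB + KZ.of rR - KZ.of rT - KZ.of rL ∈ M₁) →
    ∀ (n : ℕ) (ω : Fin n → MvPolynomial (Fin n) ℂ), (∀ i, HasAlgCoeffs (ω i)) →
    ∀ (a : ℂ), IsAlgebraic ℚ a →
    ∀ (c : ℂ) (ε ρ : ℝ) (ψ : ℂ → (Fin n → ℂ)), 0 < ρ → ρ < ε → AnalyticOnNhd ℂ ψ (Metric.ball c ε) →
      IsSemialgebraicMapOn ℚ {q : Fin 2 → ℝ | (⟨q 0, q 1⟩ : ℂ) ∈ Metric.closedBall c ρ}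
        (fun q => Fin.append (fun i => (ψ ⟨q 0, q 1⟩ i).re) (fun i => (ψ ⟨q 0, q 1⟩ i).im)) →
    ∀ (wb wr wt wl : ℝ → ℂ),
      ContDiffOn ℝ 1 wb (Set.Icc 0 1) → ContDiffOn ℝ 1 wr (Set.Icc 0 1) →
      ContDiffOn ℝ 1 wt (Set.Icc 0 1) → ContDiffOn ℝ 1 wl (Set.Icc 0 1) →
      IsSemialgebraicMapOn ℚ {z : Fin 1 → ℝ | z 0 ∈ Set.Icc (0 : ℝ) 1} (fun z => ![(wb (z 0)).re, (wb (z 0)).im]) →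
      IsSemialgebraicMapOn ℚ {z : Fin 1 → ℝ | z 0 ∈ Set.Icc (0 : ℝ) 1} (fun z => ![(wr (z 0)).re, (wr (z 0)).im]) →
      IsSemialgebraicMapOn ℚ {z : Fin 1 → ℝ | z 0 ∈ Set.Icc (0 : ℝ) 1} (fun z => ![(wt (z 0)).re, (wt (z 0)).im]) →
      IsSemialgebraicMapOn ℚ {z : Fin 1 → ℝ | z 0 ∈ Set.Icc (0 : ℝ) 1} (fun z => ![(wl (z 0)).re, (wl (z 0)).im]) →
      (∀ t ∈ Set.Icc (0 : ℝ) 1, wb t ∈ Metric.closedBall c (ρ / 4)) →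
      (∀ t ∈ Set.Icc (0 : ℝ) 1, wr t ∈ Metric.closedBall c (ρ / 4)) →
      (∀ t ∈ Set.Icc (0 : ℝ) 1, wt t ∈ Metric.closedBall c (ρ / 4)) →
      (∀ t ∈ Set.Icc (0 : ℝ) 1, wl t ∈ Metric.closedBall c (ρ / 4)) →
      wb 0 = wl 0 → wb 1 = wr 0 → wr 1 = wt 1 → wl 1 = wt 0 →
    ∀ (rb rr rt rl : KZ.IntegralRep 1),
      (rb.domain = {z | z 0 ∈ Set.Ioo (0 : ℝ) 1} ∧ ∀ z ∈ rb.domain, rb.integrand z =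
        (a * ∑ i, MvPolynomial.eval (ψ (wb (z 0))) (ω i) * deriv (fun u => ψ (wb u) i) (z 0)).re) →
      (rr.domain = {z | z 0 ∈ Set.Ioo (0 : ℝ) 1} ∧ ∀ z ∈ rr.domain, rr.integrand z =
        (a * ∑ i, MvPolynomial.eval (ψ (wr (z 0))) (ω i) * deriv (fun u => ψ (wr u) i) (z 0)).re) →
      (rt.domain = {z | z 0 ∈ Set.Ioo (0 : ℝ) 1} ∧ ∀ z ∈ rt.domain, rt.integrand z =
        (a * ∑ i, MvPolynomial.eval (ψ (wt (z 0))) (ω i) * deriv (fun u => ψ (wt u) i) (z 0)).re) →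
      (rl.domain = {z | z 0 ∈ Set.Ioo (0 : ℝ) 1} ∧ ∀ z ∈ rl.domain, rl.integrand z =
        (a * ∑ i, MvPolynomial.eval (ψ (wl (z 0))) (ω i) * deriv (fun u => ψ (wl u) i) (z 0)).re) →
      KZ.of rb + KZ.of rr - KZ.of rt - KZ.of rl ∈ M₁ := by
  intro hGreen n ω hω a ha c ε ρ ψ hρ hρε hψ hψsa wb wr wt wl hwb hwr hwt hwl swb swr swt swl mwb mwr mwt
    mwl h00 h10 h11 h01 rb rr rt rl hrb hrr hrt hrl
  -- the Coons patch, its partial derivatives, the density `g` and a primitive `G` of `g`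
  set P : (Fin 2 → ℝ) → ℂ := fun p => (1 - (p 1 : ℂ)) * wb (p 0) + (p 1 : ℂ) * wt (p 0) +
      (1 - (p 0 : ℂ)) * wl (p 1) + (p 0 : ℂ) * wr (p 1) -
    ((1 - (p 0 : ℂ)) * (1 - (p 1 : ℂ)) * wb 0 + (p 0 : ℂ) * (1 - (p 1 : ℂ)) * wb 1 +
      (1 - (p 0 : ℂ)) * (p 1 : ℂ) * wt 0 + (p 0 : ℂ) * (p 1 : ℂ) * wt 1) with hP
  set Pu : (Fin 2 → ℝ) → ℂ := fun p => (1 - (p 1 : ℂ)) * derivWithin wb (Set.Icc 0 1) (p 0) +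
      (p 1 : ℂ) * derivWithin wt (Set.Icc 0 1) (p 0) - wl (p 1) + wr (p 1) -
    (-(1 - (p 1 : ℂ)) * wb 0 + (1 - (p 1 : ℂ)) * wb 1 - (p 1 : ℂ) * wt 0 + (p 1 : ℂ) * wt 1) with hPu
  set Pv : (Fin 2 → ℝ) → ℂ := fun p => -wb (p 0) + wt (p 0) +
      (1 - (p 0 : ℂ)) * derivWithin wl (Set.Icc 0 1) (p 1) + (p 0 : ℂ) * derivWithin wr (Set.Icc 0 1) (p 1) -
    (-(1 - (p 0 : ℂ)) * wb 0 - (p 0 : ℂ) * wb 1 + (1 - (p 0 : ℂ)) * wt 0 + (p 0 : ℂ) * wt 1) with hPv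
  set g : ℂ → ℂ := fun w => ∑ i, MvPolynomial.eval (ψ w) (ω i) * deriv (fun u => ψ u i) w with hg
  obtain ⟨G, hG⟩ : Complex.IsExactOn g (Metric.ball c ε) :=
    (CellGreen.analyticOnNhd_density ω hψ).differentiableOn.isExactOn_ball
  set A : (Fin 2 → ℝ) → ℝ := fun p => (a * g (P p) * Pu p).re with hA
  set B : (Fin 2 → ℝ) → ℝ := fun p => (a * g (P p) * Pv p).re with hB
  set S : (Fin 2 → ℝ) → ℝ := fun p => (a * G (P p)).re with hS
  refine hGreen A B S ?_ ?_ ?_ ?_ ?_ rb rr rt rl hrb.1 hrr.1 hrt.1 hrl.1 ?_ ?_ ?_ ?_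
  · exact CellGreen.A_sa hω ha hρ hρε hψ hψsa hwb hwt swb swr swt swl mwb mwr mwt mwl hP hPu hg hA
  · exact CellGreen.B_sa hω ha hρ hρε hψ hψsa hwr hwl swb swr swt swl mwb mwr mwt mwl hP hPv hg hB
  · exact CellGreen.A_continuousOn hρ hρε hψ hwb hwr hwt hwl mwb mwr mwt mwl hP hPu hg hA
  · exact CellGreen.B_continuousOn hρ hρε hψ hwb hwr hwt hwl mwb mwr mwt mwl hP hPv hg hB
  · intro p h0 h0' h1 h1'
    exact CellGreen.S_hasFDerivAt hρ hρε hwb hwr hwt hwl mwb mwr mwt mwl hP hPu hPv hG hA hB hS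
      ⟨h0, h0'⟩ ⟨h1, h1'⟩
  · intro z hz
    have hz' : z 0 ∈ Set.Ioo (0 : ℝ) 1 := by rw [hrb.1] at hz; exact hz
    rw [hrb.2 z hz]
    exact (CellGreen.A_bottom hρ hρε hψ hwb mwb h00 h10 hP hPu hg hA hz').symm
  · intro z hz
    have hz' : z 0 ∈ Set.Ioo (0 : ℝ) 1 := by rw [hrr.1] at hz; exact hz
    rw [hrr.2 z hz]
    exact (CellGreen.B_right hρ hρε hψ hwr mwr hP hPv hg hB hz').symm
  · intro z hz
    have hz' : z 0 ∈ Set.Ioo (0 : ℝ) 1 := by rw [hrt.1] at hz; exact hz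
    rw [hrt.2 z hz]
    exact (CellGreen.A_top hρ hρε hψ hwt mwt h11 h01 hP hPu hg hA hz').symm
  · intro z hz
    have hz' : z 0 ∈ Set.Ioo (0 : ℝ) 1 := by rw [hrl.1] at hz; exact hz
    rw [hrl.2 z hz]
    exact (CellGreen.B_left hρ hρε hψ hwl mwl hP hPv hg hB hz').symm

end Summit.KontsevichZagierPeriods.SymplecticScissors.RealOnePeriodRelations

end
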